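import Literature.Computability.Complexity.ThreeDMMachine
import Literature.Computability.Complexity.ThreeDMVerifier
import Literature.Computability.Complexity.OneInThreeSATMachine
import HarnessLib

/-!
# Karp's Main Theorem, problem 17: `3-DIMENSIONAL MATCHING` is NP-complete (discharge of `isNPComplete_THREEDM`)

Sibling proof file of `KarpProblems.lean` (D-0014: the named fact
`Literature.Computability.Complexity.isNPComplete_THREEDM : Prop := IsNPComplete THREEDM` stays a
`def`; this file proves `isNPComplete_THREEDM_holds`). Karp 1972, §4, Main Theorem: the 21
problems, among them problem 17 3-DIMENSIONAL MATCHING, are NP-complete; Garey–Johnson 1979,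
Thm. 3.2 proves it from 3SAT. The tree's proof assembles pieces that are ALREADY in the tree
(nothing is restated here):

* `Schaefer1978_oneInThreeSAT_NPHard_holds` — ONE-IN-THREE 3SAT is NP-hard
  (`OneInThreeSATMachine.lean`: `3SAT` NP-complete by Cook–Levin, `kSAT 3 ≤ₚ ONEIN3SAT`);
* `ThreeDM.THREEDM_isNPHard_of` — `IsNPHard ONEIN3SAT → IsNPHard THREEDM` by the polynomial-time
  map `ONEIN3SAT ≤ₚ THREEDM` (`ThreeDMMachine.lean`; garbage-free ring gadget `ThreeDMGadget.lean`),
  whose docstring announces exactly this assembly;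
* `ThreeDMNP.THREEDM_mem_NP` — the matching verifier (`ThreeDMVerifier.lean`).

(In its own file, like `KarpMaxCutComplete.lean`, so that the per-problem discharges of Karp's list
stay independent of one another.)

## References

* R. M. Karp, *Reducibility among combinatorial problems*, in: R. E. Miller, J. W. Thatcher (eds.),
  Complexity of Computer Computations, Plenum 1972, 85–103, §4 Main Theorem, problem 17
  (3-DIMENSIONAL MATCHING).
* M. R. Garey, D. S. Johnson, *Computers and Intractability*, Freeman 1979, Thm. 3.2 (3DM is
  NP-complete) and [LO4] ONE-IN-THREE 3SAT (p. 259).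
* T. J. Schaefer, *The complexity of satisfiability problems*, STOC 1978, Thm. 2.1.
-/

namespace Literature.Computability.Complexity

/-- **`3-DIMENSIONAL MATCHING` is NP-hard** (Garey–Johnson 1979, Thm. 3.2; Karp 1972, problem 17):
ONE-IN-THREE 3SAT is NP-hard (`Schaefer1978_oneInThreeSAT_NPHard_holds`) and reduces to `THREEDM`
(`ThreeDM.THREEDM_isNPHard_of`). [cite: GareyJohnson1979, Thm. 3.2] [cite: Karp1972, §4 Main Theorem, problem 17] -/
theorem THREEDM_isNPHard : IsNPHard THREEDM :=
  ThreeDM.THREEDM_isNPHard_of Schaefer1978_oneInThreeSAT_NPHard_holds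

/-- **Discharge of `isNPComplete_THREEDM`** (Karp 1972, Main Theorem, problem 17 of 21):
3-DIMENSIONAL MATCHING — the tree's `THREEDM = encodingTriples.toLanguage threeDMSet` — is
NP-complete: in `NP` by the matching verifier (`ThreeDMNP.THREEDM_mem_NP`), NP-hard by
`ONEIN3SAT ≤ₚ THREEDM` (`THREEDM_isNPHard`). [cite: Karp1972, §4 Main Theorem, problem 17]
[cite: GareyJohnson1979, Thm. 3.2] -/
theorem isNPComplete_THREEDM_holds : isNPComplete_THREEDM :=
  ⟨ThreeDMNP.THREEDM_mem_NP, THREEDM_isNPHard⟩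

end Literature.Computability.Complexity
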